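import Summits.BirchSwinnertonDyer.BirchSwinnertonDyer.Theorems.SchneiderFreeAdditiveX3NATIndexIdentity
import Summits.BirchSwinnertonDyer.BirchSwinnertonDyer.Theorems.SchneiderFreeAdditiveX3AnomalousIndexInputsOfPT
import Summits.BirchSwinnertonDyer.BirchSwinnertonDyer.Theorems.EisensteinPrimesSplitMultSfTransfer
import Summits.BirchSwinnertonDyer.BirchSwinnertonDyer.Theorems.EisensteinPrimesKellerYinLemma511OfCharRH
import Summits.BirchSwinnertonDyer.BirchSwinnertonDyer.Theorems.EisensteinPrimesKellerYinLemma511IffResidualFinite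
import Summits.BirchSwinnertonDyer.BirchSwinnertonDyer.Theorems.EisensteinPrimesXAcImprimitiveLambdaShift
import Summits.BirchSwinnertonDyer.BirchSwinnertonDyer.Theorems.EisensteinPrimesFSideCorankLeOffP
import HarnessLib

/-!
# Route `SchneiderFreeAdditiveX3` (K1 door), crux r3 `GordTwoBranchIMC` (stmt-BirchSwinnertonDyer-19177): THE ALGEBRAIC λ-SIDE OF A RESIDUAL PAIR WITH
# BOTH CHARACTERS NON-TRIVIAL ON `D_v̄`, DOWN TO THE PRIMITIVE UNRAMIFIED CHARACTER DUALS, FROM THE NAT INDEX ROAD — the door inequality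
# `λ(𝔛_{θsub}) + λ(𝔛_{θquot}) + Σ_{w∈Sf}(λ𝒫_w(θsub) + λ𝒫_w(θquot)) ≤ λ(X_ac^∅(W_K)) + Σ_{w∈Sf} λ𝒫_w(W_K)` WITHOUT CGLS Prop. 1.2.5 / Cor. 1.2.6 / Prop. 14

Cell `bsd-schneider-ideate`, seat `bsd-schneider-door-c5` (prover, generation 43; assembly layer; `--supports` 19177, helper).  PARTITION: board row
B6 ∩ X3 ∩ sst-twist, `r = 1`, the (G-ord, `e = 2`) half of `Rank1Residual.partition` — the 686 NON-ANOMALOUS census pairs at `p = 3` and the 307 pairs at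
`p ≥ 5` (class-wide: every additive pair whose two Jordan–Hölder characters are non-trivial on `D_v̄`); types-the-object-of nothing new; closes none of B6's
cells (BSD NOT advanced).  bears_on: K1-door (items 18971/18972/18974 retired since rev 3 → live crux r3 19177).  FILE D of this generation's NAT port of cell
`bsd-eis`'s V21 index road (A `…NATResidualIndexAssembly` p764900 · B `…NATIndexLocalHZero` p765048 · C `…NATIndexIdentity`).

## What

For `W/ℚ` globally minimal with ADDITIVE reduction at an odd `p` (`Addv W p`), `K` imaginary quadratic Heegner for `N_W` with `(p) = v v̄`,
`κ` anticyclotomic with generator `γ`, `(θsub, θquot)` a residual pair of `W_K[p]` with BOTH characters non-trivial on `D_v̄`, and `Sf` the places over `N_W`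
OFF `p` (the door's convention):
* §1 `lambdaInvariant_add_eq_of_decomp_ne_one_offP` — FILE C's λ-identity `λ(DSsub.X) + λ(DSquot.X) = λ(X_ac^{Sf}(W_K))` over the door's `p`-free `Sf`
  (x2's off-`p` transfers: the x1 set `Sf ∪ {v, v̄}` and `Sf` define the same Selmer groups).
* §2 `xAc_clauses_of_primitive_clauses` — [INV.μ] FROM THE PRIMITIVE CHARACTER CLAUSES: if every PRIMITIVE unramified dual datum of `(F/𝒪)(θsub)` and of
  `(F/𝒪)(θquot)` is f.g. `Λ`-torsion with `μ = 0`, then so is every `Sf`-imprimitive one (F40a's bad-place shift `imprimitive_clauses_of_not_good`, Milne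
  ADT I 4.10 (a) fed by the tree), hence `X_ac^{Sf}(W_K)` is f.g. `Λ`-torsion with `μ = 0` and `X_ac^∅(W_K)` is torsion with `μ = 0` (cell `bsd-eis`'s
  `KellerYinLemma511OfCharRH` dévissage + Greenberg's criterion, reduction-free).
* §3 `lambdaInvariant_primitive_add_sum_eq_of_decomp_ne_one` — `λ(Dsub.X) + λ(Dquot.X) + Σ_{w∈Sf}(λ𝒫_w(θsub) + λ𝒫_w(θquot)) = λ(X_ac^{Sf}(W_K))` (§1 + the
  shift's λ-clause + §2), an EQUALITY.
* §4 **`add_add_sum_le_lambdaInvariant_xAc_empty_add_sum_curveLocalLambda_of_decomp_ne_one`** — THE DOOR INEQUALITY in the shape the door's hinge consumes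
  (this seat's `KYLambdaAlgOfCGLS.…_of_nonAnomalous_ofCGLS`, F38a §3, which displays CGLS 2022 Prop. 1.2.5 ×2, Prop. 14, Cor. 1.2.6 (i)(ii), Milne I 4.10 (a)):
  here from §3 + `bsd-eis`'s λ-shift and `corank ≤ Σ λ𝒫_w(W_K)` — NO named hypothesis beyond the two PRIMITIVE character clauses (`hRHsub`, `hRHquot`), which
  the door feeds from the [BR𝟙]/[BRω] roads at `p = 3` and from CGLS Prop. 1.2.5's module clause at `p ≥ 5` (FILE E).  Also returned: `X_ac^∅` torsion, `μ = 0`.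
HONEST FRAMING: compositions of tree theorems; no definition, no named fact, no `sorry`; nothing analytic; nothing about BSD or a main conjecture is asserted;
«closes rung: none».  References: [KellerYin2024] Thm. 1.4.1, Prop. 1.2.5, Lemma 5.1.1, §1.4 (arXiv:2402.12781v2); [GreenbergLNM1716] §1 p. 60;
[GreenbergVatsal2000] §2 Prop. (2.8), Cor. (2.3); [MilneADT2006] I Thm. 4.10 (a); this seat F40a–c (anomalous templates), F49a–c.
-/

set_option autoImplicit false
-- the route's Theorems namespace repeats the summit name by design (D-0017 nested layout)
set_option linter.dupNamespace false

noncomputable section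

open scoped Classical

namespace Summit.BirchSwinnertonDyer.BirchSwinnertonDyer.Theorems.SchneiderFreeAdditiveX3.NATLambdaAlgebraicSide

open PowerSeries WeierstrassCurve NumberField IsDedekindDomain Field
  Literature.NumberTheory.GaloisRepresentations Literature.NumberTheory.EllipticCurves.GreenbergVatsal2000
  Literature.NumberTheory.EllipticCurves Literature.NumberTheory.EllipticCurves.Rank1Residual
  Literature.NumberTheory.EllipticCurves.Castella2018 Literature.NumberTheory.EllipticCurves.GreenbergSelmer
  Literature.NumberTheory.QuadraticFields Literature.NumberTheory.EllipticCurves.KellerYin2024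
  Literature.NumberTheory.EllipticCurves.IwasawaAlgebra Literature.NumberTheory.IwasawaTheory
  Literature.NumberTheory.GaloisCohomology
  Summit.BirchSwinnertonDyer.Rank1Residual.X2.ResidualDevissageModules
  Summit.BirchSwinnertonDyer.BirchSwinnertonDyer.Theorems
  Summit.BirchSwinnertonDyer.BirchSwinnertonDyer.Theorems.SplitMultSfTransfer
  Summit.BirchSwinnertonDyer.BirchSwinnertonDyer.Theorems.SchneiderFreeAdditiveX3
open Summit.BirchSwinnertonDyer.BirchSwinnertonDyer.Theorems.PoitouTateShaNaturalAtTC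
  (forall_poitouTate_shaRestricted_tateDual_natural_at_of_isTotallyComplex)

variable {K : Type} [Field K] [NumberField K] {p : ℕ} [hp : Fact p.Prime]

/-! ### §0 `W(K)[p] = 0` for a pair with both characters non-trivial on `D_v̄` -/

/-- **`W(K)[p] = 0` when both residual characters are non-trivial on `D_v̄`** (any `ℤ_p`-extension `κ` in scope): a `K`-rational `p`-torsion point is a
`Γ_K`-fixed vector of `W_K[p]`, in particular fixed by `ker κ ⊓ D_v̄`, and `W_K[p]^{ker κ ⊓ D_v̄} = 0` along the stable line of the pair (FILE B
`geomTorsion_eq_zero_of_fixed_inf_decomp`).  Discharges the `htor` binder of FILE C at the door's data. [cite: GreenbergLNM1716, §4 p. 109]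
[cite: KellerYin2024, §1.4 (arXiv:2402.12781v2 TeX L1083) («we could always assume `H⁰(K, ρ̄_f) = 0`»)] -/
theorem forall_baseChange_nsmul_eq_zero_of_decomp_ne_one
    (W : WeierstrassCurve ℚ) [W.IsElliptic] (K : Type) [Field K] [NumberField K]
    (vbar : HeightOneSpectrum (𝓞 K)) (κ : ZpExtension K p)
    {θsub θquot : FramedGaloisRep K (padicCoeffIntegers (∅ : Set (PadicAlgCl p))) 1}
    (hpair : IsResidualPairOver (W.baseChange K) p θsub θquot)
    (hsubD : ∃ τ ∈ decomp vbar, unitChar θsub τ ≠ 1) (hquotD : ∃ τ ∈ decomp vbar, unitChar θquot τ ≠ 1) :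
    ∀ Q : (W.baseChange K).toAffine.Point, p • Q = 0 → Q = 0 := by
  haveI hEK : (W.baseChange K).IsElliptic := inferInstanceAs (W.map (algebraMap ℚ K)).IsElliptic
  have hθsub : ∀ σ : absoluteGaloisGroup K, θsub σ ^ (p - 1) = 1 := fun σ ↦ (hpair.pow_sub_one σ).1
  have hθquot : ∀ σ : absoluteGaloisGroup K, θquot σ ^ (p - 1) = 1 := fun σ ↦ (hpair.pow_sub_one σ).2
  obtain ⟨Φ, -, -, ⟨j₁, hj₁, hj₁inj, -⟩, ⟨j₃, hj₃, hj₃inj, -⟩⟩ :=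
    ResidualPairStableLine.exists_stableLine_of_isResidualPairOver (W.baseChange K) hpair
  have hE := NATIndexLocalHZero.geomTorsion_eq_zero_of_fixed_inf_decomp κ vbar (W.baseChange K) Φ
    (NATIndexLocalHZero.eq_zero_of_fixed_inf_decomp_of_hom κ vbar θsub hθsub j₁ hj₁ hj₁inj hsubD)
    (NATIndexLocalHZero.eq_zero_of_fixed_inf_decomp_of_hom κ vbar θquot hθquot j₃ hj₃ hj₃inj hquotD)
  intro Q hQ
  -- the geometric point of `Q`, fixed by `Γ_K`, killed by `p`
  set R : geomPoints (W.baseChange K) := (W.baseChange K).toGeomPoints Q with hR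
  have hRfix : ∀ g : absoluteGaloisGroup K, g • R = R := fun g ↦ (W.baseChange K).smul_toGeomPoints g Q
  have hRp : ((p : ℕ) : ℤ) • R = 0 := by
    rw [hR, natCast_zsmul, ← map_nsmul, hQ, map_zero]
  set R' : ↥((W.baseChange K).geomTorsion ((p : ℕ) : ℤ)) := ⟨R, (Submodule.mem_torsionBy_iff _ _).mpr hRp⟩ with hR'
  have hR'fix : ∀ g : ↥(κ.kerSubgroup ⊓ decomp vbar), g • R' = R' := fun g ↦ Subtype.ext (by
    rw [Subgroup.smul_def, AddSubgroup.torsionBy.coe_smul]; exact hRfix g)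
  have h0 : R' = 0 := hE R' hR'fix
  exact (W.baseChange K).toGeomPoints_injective (by
    rw [← hR, map_zero]; exact congrArg Subtype.val h0)

/-! ### §1 The λ-identity over the door's `p`-free `Sf` -/

/-- **Keller–Yin's λ-identity for a pair with both characters non-trivial on `D_v̄`, IN THE DOOR's CURRENCY** (`Sf` the `p`-free places over `N_W`):
`λ(DSsub.X) + λ(DSquot.X) = λ(X_ac^{Sf}(W_K))` — FILE C run over `Sf ∪ {v, v̄}` (the x1 set at an additive `p`) and transferred by x2's `SplitMultSfTransfer`.
No named hypothesis. [cite: KellerYin2024, Thm. 1.4.1 (iii), §1 (S = Σ ∖ {v, v̄, ∞}) (arXiv:2402.12781v2)] [cite: Castella2018, Def. 2.2] -/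
theorem lambdaInvariant_add_eq_of_decomp_ne_one_offP
    (W : WeierstrassCurve ℚ) [W.IsElliptic] [W.IsGloballyMinimal] (hp2 : 2 < p) (haddv : Addv W p)
    (K : Type) [Field K] [NumberField K] (hK : IsImaginaryQuadratic K)
    (hH : SatisfiesHeegnerHypothesis (W.conductorNorm ℤ) K)
    (ι : K →+* ℚ_[p]) (v vbar : HeightOneSpectrum (𝓞 K))
    (hv : ∀ x : 𝓞 K, x ∈ v.asIdeal ↔ ‖ι (x : K)‖ < 1)
    (hvbar : ((p : ℕ) : 𝓞 K) ∈ vbar.asIdeal) (hne : vbar ≠ v)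
    (κ : ZpExtension K p) (hκ : κ.IsAnticyclotomic)
    (γ : absoluteGaloisGroup K) [Fact (κ.IsTopGenerator γ)]
    (θsub θquot : FramedGaloisRep K (padicCoeffIntegers (∅ : Set (PadicAlgCl p))) 1)
    (hpair : IsResidualPairOver (W.baseChange K) p θsub θquot)
    (hsubD : ∃ τ ∈ decomp vbar, unitChar θsub τ ≠ 1) (hquotD : ∃ τ ∈ decomp vbar, unitChar θquot τ ≠ 1)
    (Sf : Finset (HeightOneSpectrum (𝓞 K)))
    (hSf : ∀ w : HeightOneSpectrum (𝓞 K), w ∈ Sf ↔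
      (((W.conductorNorm ℤ : ℤ) : 𝓞 K) ∈ w.asIdeal ∧ ((p : ℕ) : 𝓞 K) ∉ w.asIdeal))
    (DSsub : DatumDualData κ γ (charModule ∅ θsub)
        (AcSelmer.bdpData (charModule ∅ θsub) p vbar) (↑Sf : Set (HeightOneSpectrum (𝓞 K))))
    (DSquot : DatumDualData κ γ (charModule ∅ θquot)
        (AcSelmer.bdpData (charModule ∅ θquot) p vbar) (↑Sf : Set (HeightOneSpectrum (𝓞 K))))
    (hfgS : Module.Finite (IwasawaAlgebra p) (AcSelmer.XAc (W.baseChange K) p κ vbar (↑Sf : Set (HeightOneSpectrum (𝓞 K))) γ))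
    (htorS : Module.IsTorsion (IwasawaAlgebra p) (AcSelmer.XAc (W.baseChange K) p κ vbar (↑Sf : Set (HeightOneSpectrum (𝓞 K))) γ))
    (hμS : muInvariant p (AcSelmer.XAc (W.baseChange K) p κ vbar (↑Sf : Set (HeightOneSpectrum (𝓞 K))) γ) = 0)
    (hSsub : ∀ D : DatumDualData κ γ (charModule ∅ θsub)
        (AcSelmer.bdpData (charModule ∅ θsub) p vbar) (↑Sf : Set (HeightOneSpectrum (𝓞 K))),
      Module.Finite (IwasawaAlgebra p) D.X ∧ Module.IsTorsion (IwasawaAlgebra p) D.X ∧ muInvariant p D.X = 0)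
    (hSquot : ∀ D : DatumDualData κ γ (charModule ∅ θquot)
        (AcSelmer.bdpData (charModule ∅ θquot) p vbar) (↑Sf : Set (HeightOneSpectrum (𝓞 K))),
      Module.Finite (IwasawaAlgebra p) D.X ∧ Module.IsTorsion (IwasawaAlgebra p) D.X ∧ muInvariant p D.X = 0) :
    lambdaInvariant p DSsub.X + lambdaInvariant p DSquot.X =
      lambdaInvariant p (AcSelmer.XAc (W.baseChange K) p κ vbar (↑Sf : Set (HeightOneSpectrum (𝓞 K))) γ) := by
  have hpv : ((p : ℕ) : 𝓞 K) ∈ v.asIdeal := IndexPlumbingNrVsStrict.natCast_mem_asIdeal_of_forall_norm_iff hv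
  -- the x1-convention set `SN = Sf ∪ {v, v̄}` and its agreement with `Sf` off `p`
  set SN : Finset (HeightOneSpectrum (𝓞 K)) := insert v (insert vbar Sf) with hSNdef
  have hSp : ∀ w : HeightOneSpectrum (𝓞 K), ((p : ℕ) : 𝓞 K) ∈ w.asIdeal →
      w ∈ (↑(insert v (insert vbar Sf)) : Set (HeightOneSpectrum (𝓞 K))) :=
    AcTwistDeformationResidualPair.mem_insert_insert_of_natCast_mem hK hpv hvbar hne Sf
  have hSN : ∀ w : HeightOneSpectrum (𝓞 K), w ∈ SN ↔ ((W.conductorNorm ℤ : ℤ) : 𝓞 K) ∈ w.asIdeal := by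
    intro w
    constructor
    · intro hw
      rw [hSNdef, Finset.mem_insert, Finset.mem_insert] at hw
      rcases hw with rfl | rfl | hw
      · exact AnomalousTwistLambdaLEOffP.conductorNorm_mem_of_natCast_mem_of_addv W haddv hpv
      · exact AnomalousTwistLambdaLEOffP.conductorNorm_mem_of_natCast_mem_of_addv W haddv hvbar
      · exact ((hSf w).mp hw).1
    · intro hN
      by_cases hpw : ((p : ℕ) : 𝓞 K) ∈ w.asIdeal
      · have h := hSp w hpw
        rw [Finset.mem_coe] at h
        rw [hSNdef]; exact h
      · rw [hSNdef, Finset.mem_insert, Finset.mem_insert]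
        exact Or.inr (Or.inr ((hSf w).mpr ⟨hN, hpw⟩))
  have hoff : ∀ w : HeightOneSpectrum (𝓞 K), ((p : ℕ) : 𝓞 K) ∉ w.asIdeal →
      (w ∈ (↑Sf : Set (HeightOneSpectrum (𝓞 K))) ↔ w ∈ (↑SN : Set (HeightOneSpectrum (𝓞 K)))) := by
    intro w hpw
    rw [Finset.mem_coe, Finset.mem_coe, hSNdef, Finset.mem_insert, Finset.mem_insert]
    constructor
    · exact fun hw ↦ Or.inr (Or.inr hw)
    · rintro (rfl | rfl | hw)
      · exact absurd hpv hpw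
      · exact absurd hvbar hpw
      · exact hw
  have hoff' : ∀ w : HeightOneSpectrum (𝓞 K), ((p : ℕ) : 𝓞 K) ∉ w.asIdeal →
      (w ∈ (↑SN : Set (HeightOneSpectrum (𝓞 K))) ↔ w ∈ (↑Sf : Set (HeightOneSpectrum (𝓞 K)))) :=
    fun w hpw ↦ (hoff w hpw).symm
  -- transfer of the curve-side invariants `Sf → SN`
  haveI hEK : (W.baseChange K).IsElliptic := inferInstanceAs (W.map (algebraMap ℚ K)).IsElliptic
  have hsel : AcSelmer.selmerAc (W.baseChange K) p κ vbar (↑Sf : Set (HeightOneSpectrum (𝓞 K))) =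
      AcSelmer.selmerAc (W.baseChange K) p κ vbar (↑SN : Set (HeightOneSpectrum (𝓞 K))) :=
    selmerAc_congr_offP κ (W.baseChange K) vbar hoff
  obtain ⟨hfgT, htorT, hμT, hlamT⟩ := xAc_invariants_congr (W.baseChange K) p κ vbar γ hsel
  have hfgS' := hfgT hfgS
  have htorS' := htorT htorS
  have hμS' : muInvariant p (AcSelmer.XAc (W.baseChange K) p κ vbar (↑SN : Set (HeightOneSpectrum (𝓞 K))) γ) = 0 := by
    rw [← hμT]; exact hμS
  -- transfer of the character-side `∀ D` clauses `Sf → SN`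
  have hSsub' : ∀ D : DatumDualData κ γ (charModule ∅ θsub)
      (AcSelmer.bdpData (charModule ∅ θsub) p vbar) (↑SN : Set (HeightOneSpectrum (𝓞 K))),
      Module.Finite (IwasawaAlgebra p) D.X ∧ Module.IsTorsion (IwasawaAlgebra p) D.X ∧ muInvariant p D.X = 0 := fun D ↦
    prop_datumDualData_congr_offP κ (AcSelmer.bdpData (charModule ∅ θsub) p vbar) hoff'
      (fun X _ _ ↦ Module.Finite (IwasawaAlgebra p) X ∧ Module.IsTorsion (IwasawaAlgebra p) X ∧ muInvariant p X = 0) hSsub D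
  have hSquot' : ∀ D : DatumDualData κ γ (charModule ∅ θquot)
      (AcSelmer.bdpData (charModule ∅ θquot) p vbar) (↑SN : Set (HeightOneSpectrum (𝓞 K))),
      Module.Finite (IwasawaAlgebra p) D.X ∧ Module.IsTorsion (IwasawaAlgebra p) D.X ∧ muInvariant p D.X = 0 := fun D ↦
    prop_datumDualData_congr_offP κ (AcSelmer.bdpData (charModule ∅ θquot) p vbar) hoff'
      (fun X _ _ ↦ Module.Finite (IwasawaAlgebra p) X ∧ Module.IsTorsion (IwasawaAlgebra p) X ∧ muInvariant p X = 0) hSquot D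
  -- the `SN`-statement for every pair of `SN`-dual data (FILE C)
  have hmain : ∀ (D₁ : DatumDualData κ γ (charModule ∅ θsub)
        (AcSelmer.bdpData (charModule ∅ θsub) p vbar) (↑SN : Set (HeightOneSpectrum (𝓞 K))))
      (D₃ : DatumDualData κ γ (charModule ∅ θquot)
        (AcSelmer.bdpData (charModule ∅ θquot) p vbar) (↑SN : Set (HeightOneSpectrum (𝓞 K)))),
      lambdaInvariant p D₁.X + lambdaInvariant p D₃.X =
        lambdaInvariant p (AcSelmer.XAc (W.baseChange K) p κ vbar (↑Sf : Set (HeightOneSpectrum (𝓞 K))) γ) := by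
    intro D₁ D₃
    rw [hlamT]
    exact NATIndexIdentity.lambdaInvariant_add_eq_of_decomp_ne_one W hp2 K hK hH
      (forall_baseChange_nsmul_eq_zero_of_decomp_ne_one W K vbar κ hpair hsubD hquotD) ι v vbar hv hvbar hne κ hκ γ θsub θquot hpair hsubD
      hquotD SN hSN D₁ D₃ hfgS' htorS' hμS' hSsub' hSquot'
  -- transfer of the conclusion `SN → Sf` (twice)
  exact prop_datumDualData_congr_offP κ (AcSelmer.bdpData (charModule ∅ θsub) p vbar) hoff
    (fun X _ _ ↦ lambdaInvariant p X + lambdaInvariant p DSquot.X =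
      lambdaInvariant p (AcSelmer.XAc (W.baseChange K) p κ vbar (↑Sf : Set (HeightOneSpectrum (𝓞 K))) γ))
    (fun D₁ ↦ prop_datumDualData_congr_offP κ (AcSelmer.bdpData (charModule ∅ θquot) p vbar) hoff
      (fun Y _ _ ↦ lambdaInvariant p D₁.X + lambdaInvariant p Y =
        lambdaInvariant p (AcSelmer.XAc (W.baseChange K) p κ vbar (↑Sf : Set (HeightOneSpectrum (𝓞 K))) γ))
      (fun D₃ ↦ hmain D₁ D₃) DSquot) DSsub

/-! ### §2 [INV.μ] from the PRIMITIVE character clauses -/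

/-- **[INV.μ] + the torsion clause FROM THE PRIMITIVE CHARACTER CLAUSES, reduction-free:** for `W/ℚ` globally minimal with bad reduction at an odd `p`, `K`
imaginary quadratic Heegner for `N_W` with `(p) = v v̄`, `κ` anticyclotomic with generator `γ`, `(θsub, θquot)` a residual pair of `W_K[p]`, `Sf` the `p`-free
places over `N_W`: IF every PRIMITIVE unramified dual datum of `(F/𝒪)(θsub)` and of `(F/𝒪)(θquot)` is f.g. `Λ`-torsion with `μ = 0`, THEN (i) so is every
`Sf`-imprimitive one (F40a's bad-place shift `BadPrimeCharImprimitiveShiftOfPT.imprimitive_clauses_of_not_good`, Milne ADT I 4.10 (a) by the tree's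
`forall_poitouTate_shaRestricted_tateDual_natural_at_of_isTotallyComplex`), (ii) `X_ac^{Sf}(W_K)` is f.g. `Λ`-torsion with `μ = 0` and (iii) `X_ac^∅(W_K)` is
torsion with `μ = 0` (cell `bsd-eis`'s `KellerYinLemma511OfCharRH` / `…ResidualFinite`).  No orientation hypothesis, no named hypothesis.
[cite: KellerYin2024, Prop. 1.2.5, Lemma 5.1.1, Thm. 1.4.1 (arXiv:2402.12781v2)] [cite: GreenbergLNM1716, §1 p. 60] [cite: GreenbergVatsal2000, §2 Prop. (2.8), Cor. (2.3)] -/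
theorem xAc_clauses_of_primitive_clauses
    (W : WeierstrassCurve ℚ) [W.IsElliptic] [W.IsGloballyMinimal] (hp2 : 2 < p) (hbad : ¬ W.HasGoodReductionAtPrime p)
    (K : Type) [Field K] [NumberField K] (hK : IsImaginaryQuadratic K)
    (hH : SatisfiesHeegnerHypothesis (W.conductorNorm ℤ) K)
    (ι : K →+* ℚ_[p]) (v vbar : HeightOneSpectrum (𝓞 K))
    (hv : ∀ x : 𝓞 K, x ∈ v.asIdeal ↔ ‖ι (x : K)‖ < 1)
    (hvbar : ((p : ℕ) : 𝓞 K) ∈ vbar.asIdeal) (hne : vbar ≠ v)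
    (κ : ZpExtension K p) (hκ : κ.IsAnticyclotomic)
    (γ : absoluteGaloisGroup K) [hγ : Fact (κ.IsTopGenerator γ)]
    (θsub θquot : FramedGaloisRep K (padicCoeffIntegers (∅ : Set (PadicAlgCl p))) 1)
    (hpair : IsResidualPairOver (W.baseChange K) p θsub θquot)
    (Sf : Finset (HeightOneSpectrum (𝓞 K)))
    (hSf : ∀ w : HeightOneSpectrum (𝓞 K), w ∈ Sf ↔
      (((W.conductorNorm ℤ : ℤ) : 𝓞 K) ∈ w.asIdeal ∧ ((p : ℕ) : 𝓞 K) ∉ w.asIdeal))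
    (hRHsub : ∀ D : DatumDualData κ γ (charModule ∅ θsub)
        (AcSelmer.bdpData (charModule ∅ θsub) p vbar) (∅ : Set (HeightOneSpectrum (𝓞 K))),
      Module.Finite (IwasawaAlgebra p) D.X ∧ Module.IsTorsion (IwasawaAlgebra p) D.X ∧ muInvariant p D.X = 0)
    (hRHquot : ∀ D : DatumDualData κ γ (charModule ∅ θquot)
        (AcSelmer.bdpData (charModule ∅ θquot) p vbar) (∅ : Set (HeightOneSpectrum (𝓞 K))),
      Module.Finite (IwasawaAlgebra p) D.X ∧ Module.IsTorsion (IwasawaAlgebra p) D.X ∧ muInvariant p D.X = 0) :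
    (∀ DS : DatumDualData κ γ (charModule ∅ θsub)
        (AcSelmer.bdpData (charModule ∅ θsub) p vbar) (↑Sf : Set (HeightOneSpectrum (𝓞 K))),
      Module.Finite (IwasawaAlgebra p) DS.X ∧ Module.IsTorsion (IwasawaAlgebra p) DS.X ∧ muInvariant p DS.X = 0) ∧
    (∀ DS : DatumDualData κ γ (charModule ∅ θquot)
        (AcSelmer.bdpData (charModule ∅ θquot) p vbar) (↑Sf : Set (HeightOneSpectrum (𝓞 K))),
      Module.Finite (IwasawaAlgebra p) DS.X ∧ Module.IsTorsion (IwasawaAlgebra p) DS.X ∧ muInvariant p DS.X = 0) ∧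
    (Module.Finite (IwasawaAlgebra p) (AcSelmer.XAc (W.baseChange K) p κ vbar (↑Sf : Set (HeightOneSpectrum (𝓞 K))) γ) ∧
      Module.IsTorsion (IwasawaAlgebra p) (AcSelmer.XAc (W.baseChange K) p κ vbar (↑Sf : Set (HeightOneSpectrum (𝓞 K))) γ) ∧
      muInvariant p (AcSelmer.XAc (W.baseChange K) p κ vbar (↑Sf : Set (HeightOneSpectrum (𝓞 K))) γ) = 0) ∧
    (Module.IsTorsion (IwasawaAlgebra p) (AcSelmer.XAc (W.baseChange K) p κ vbar (∅ : Set (HeightOneSpectrum (𝓞 K))) γ) ∧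
      muInvariant p (AcSelmer.XAc (W.baseChange K) p κ vbar (∅ : Set (HeightOneSpectrum (𝓞 K))) γ) = 0) := by
  haveI hEK : (W.baseChange K).IsElliptic := inferInstanceAs (W.map (algebraMap ℚ K)).IsElliptic
  have hp : p ≠ 2 := by omega
  have hθsub : ∀ σ : absoluteGaloisGroup K, θsub σ ^ (p - 1) = 1 := fun σ ↦ (hpair.pow_sub_one σ).1
  have hθquot : ∀ σ : absoluteGaloisGroup K, θquot σ ^ (p - 1) = 1 := fun σ ↦ (hpair.pow_sub_one σ).2
  obtain ⟨Dsub⟩ := nonempty_unrDualData_char (∅ : Set (PadicAlgCl p)) θsub κ vbar (∅ : Set (HeightOneSpectrum (𝓞 K))) hγ.out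
  obtain ⟨Dquot⟩ := nonempty_unrDualData_char (∅ : Set (PadicAlgCl p)) θquot κ vbar (∅ : Set (HeightOneSpectrum (𝓞 K))) hγ.out
  -- (i) the bad-place shift for both characters
  have hSs : ∀ DS : DatumDualData κ γ (charModule ∅ θsub)
      (AcSelmer.bdpData (charModule ∅ θsub) p vbar) (↑Sf : Set (HeightOneSpectrum (𝓞 K))),
      Module.Finite (IwasawaAlgebra p) DS.X ∧ Module.IsTorsion (IwasawaAlgebra p) DS.X ∧ muInvariant p DS.X = 0 := fun DS ↦ by
    obtain ⟨h1, h2, h3, -⟩ := BadPrimeCharImprimitiveShiftOfPT.imprimitive_clauses_of_not_good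
      forall_poitouTate_shaRestricted_tateDual_natural_at_of_isTotallyComplex W hp2 hbad hK hH hv hvbar hne κ hκ γ hpair Sf hSf θsub
      (Or.inl rfl) hRHsub Dsub DS
    exact ⟨h1, h2, h3⟩
  have hSq : ∀ DS : DatumDualData κ γ (charModule ∅ θquot)
      (AcSelmer.bdpData (charModule ∅ θquot) p vbar) (↑Sf : Set (HeightOneSpectrum (𝓞 K))),
      Module.Finite (IwasawaAlgebra p) DS.X ∧ Module.IsTorsion (IwasawaAlgebra p) DS.X ∧ muInvariant p DS.X = 0 := fun DS ↦ by
    obtain ⟨h1, h2, h3, -⟩ := BadPrimeCharImprimitiveShiftOfPT.imprimitive_clauses_of_not_good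
      forall_poitouTate_shaRestricted_tateDual_natural_at_of_isTotallyComplex W hp2 hbad hK hH hv hvbar hne κ hκ γ hpair Sf hSf θquot
      (Or.inr rfl) hRHquot Dquot DS
    exact ⟨h1, h2, h3⟩
  -- (ii)–(iii) the dévissage + Greenberg's criterion
  obtain ⟨DSsub⟩ := nonempty_unrDualData_char (∅ : Set (PadicAlgCl p)) θsub κ vbar (↑Sf : Set (HeightOneSpectrum (𝓞 K))) hγ.out
  obtain ⟨DSquot⟩ := nonempty_unrDualData_char (∅ : Set (PadicAlgCl p)) θquot κ vbar (↑Sf : Set (HeightOneSpectrum (𝓞 K))) hγ.out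
  have hdec : ¬ (decomp vbar ≤ κ.kerSubgroup) :=
    ZpExtension.decomp_not_le_kerSubgroup_above_of_isAnticyclotomic_holds K p hK hp κ hκ vbar hvbar
  have hgood : ∀ w : HeightOneSpectrum (𝓞 K), w ∉ (↑Sf : Set (HeightOneSpectrum (𝓞 K))) → ((p : ℕ) : 𝓞 K) ∉ w.asIdeal →
      (W.baseChange K).HasGoodReductionAt w :=
    fun w hw hpw ↦ KellerYinLemma511OfCharRH.hasGoodReductionAt_of_notMem_of_b1 W Sf hSf w hw hpw
  have hfin := KellerYinLemma511OfCharRH.finite_selmerAc_pTorsion_of_residualPair_of_dualData (W.baseChange K) κ γ hvbar hdec hgood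
    hθsub hθquot hpair DSsub DSquot (hSs DSsub) (hSq DSquot)
  exact ⟨hSs, hSq,
    KellerYinLemma511OfCharRH.isTorsion_muInvariant_eq_zero_of_residualPair_of_dualData (W.baseChange K) κ γ hvbar hdec (Sf.finite_toSet)
      hgood hθsub hθquot hpair DSsub DSquot (hSs DSsub) (hSq DSquot),
    KellerYinLemma511ResidualFinite.isTorsion_muInvariant_eq_zero_empty_of_residualFinite (W.baseChange K) κ vbar γ _ hfin⟩

/-! ### §3 The algebraic side down to the primitive duals: an EQUALITY -/

/-- **THE ALGEBRAIC λ-SIDE DOWN TO THE PRIMITIVE UNRAMIFIED DUALS, for a pair with both characters non-trivial on `D_v̄`, as an EQUALITY:**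
`λ(Dsub.X) + λ(Dquot.X) + Σ_{w∈Sf}(λ𝒫_w(θsub) + λ𝒫_w(θquot)) = λ(X_ac^{Sf}(W_K))` for any primitive unramified dual data `Dsub`, `Dquot` (binders of §1 with
`Addv W p`; `Sf` the `p`-free places over `N_W`), GIVEN only the primitive clauses `hRHsub`, `hRHquot`: §1 at the imprimitive data + the shift's λ-clause
`λ(DS.X) = λ(D.X) + Σ λ𝒫_w(θ)` (F40a §1) + §2 for the cotorsion inputs.  No named hypothesis.
[cite: KellerYin2024, Thm. 1.4.1 (iii), Prop. 1.2.5 (arXiv:2402.12781v2)] [cite: GreenbergVatsal2000, §2 Cor. (2.3)] [cite: MilneADT2006, I Thm. 4.10 (a)] -/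
theorem lambdaInvariant_primitive_add_sum_eq_of_decomp_ne_one
    (W : WeierstrassCurve ℚ) [W.IsElliptic] [W.IsGloballyMinimal] (hp2 : 2 < p) (haddv : Addv W p)
    (K : Type) [Field K] [NumberField K] (hK : IsImaginaryQuadratic K)
    (hH : SatisfiesHeegnerHypothesis (W.conductorNorm ℤ) K)
    (ι : K →+* ℚ_[p]) (v vbar : HeightOneSpectrum (𝓞 K))
    (hv : ∀ x : 𝓞 K, x ∈ v.asIdeal ↔ ‖ι (x : K)‖ < 1)
    (hvbar : ((p : ℕ) : 𝓞 K) ∈ vbar.asIdeal) (hne : vbar ≠ v)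
    (κ : ZpExtension K p) (hκ : κ.IsAnticyclotomic)
    (γ : absoluteGaloisGroup K) [hγ : Fact (κ.IsTopGenerator γ)]
    (θsub θquot : FramedGaloisRep K (padicCoeffIntegers (∅ : Set (PadicAlgCl p))) 1)
    (hpair : IsResidualPairOver (W.baseChange K) p θsub θquot)
    (hsubD : ∃ τ ∈ decomp vbar, unitChar θsub τ ≠ 1) (hquotD : ∃ τ ∈ decomp vbar, unitChar θquot τ ≠ 1)
    (Sf : Finset (HeightOneSpectrum (𝓞 K)))
    (hSf : ∀ w : HeightOneSpectrum (𝓞 K), w ∈ Sf ↔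
      (((W.conductorNorm ℤ : ℤ) : 𝓞 K) ∈ w.asIdeal ∧ ((p : ℕ) : 𝓞 K) ∉ w.asIdeal))
    (Dsub : DatumDualData κ γ (charModule ∅ θsub)
        (AcSelmer.bdpData (charModule ∅ θsub) p vbar) (∅ : Set (HeightOneSpectrum (𝓞 K))))
    (Dquot : DatumDualData κ γ (charModule ∅ θquot)
        (AcSelmer.bdpData (charModule ∅ θquot) p vbar) (∅ : Set (HeightOneSpectrum (𝓞 K))))
    (hRHsub : ∀ D : DatumDualData κ γ (charModule ∅ θsub)
        (AcSelmer.bdpData (charModule ∅ θsub) p vbar) (∅ : Set (HeightOneSpectrum (𝓞 K))),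
      Module.Finite (IwasawaAlgebra p) D.X ∧ Module.IsTorsion (IwasawaAlgebra p) D.X ∧ muInvariant p D.X = 0)
    (hRHquot : ∀ D : DatumDualData κ γ (charModule ∅ θquot)
        (AcSelmer.bdpData (charModule ∅ θquot) p vbar) (∅ : Set (HeightOneSpectrum (𝓞 K))),
      Module.Finite (IwasawaAlgebra p) D.X ∧ Module.IsTorsion (IwasawaAlgebra p) D.X ∧ muInvariant p D.X = 0) :
    lambdaInvariant p Dsub.X + lambdaInvariant p Dquot.X +
        ∑ w ∈ Sf, (charLocalLambda ∅ κ θsub w + charLocalLambda ∅ κ θquot w) =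
      lambdaInvariant p (AcSelmer.XAc (W.baseChange K) p κ vbar (↑Sf : Set (HeightOneSpectrum (𝓞 K))) γ) := by
  obtain ⟨DSsub⟩ := nonempty_unrDualData_char (∅ : Set (PadicAlgCl p)) θsub κ vbar (↑Sf : Set (HeightOneSpectrum (𝓞 K))) hγ.out
  obtain ⟨DSquot⟩ := nonempty_unrDualData_char (∅ : Set (PadicAlgCl p)) θquot κ vbar (↑Sf : Set (HeightOneSpectrum (𝓞 K))) hγ.out
  -- the λ-shifts of the two characters (F40a §1), the cotorsion inputs (§2), the λ-identity at the imprimitive data (§1)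
  have hlsub : lambdaInvariant p DSsub.X = lambdaInvariant p Dsub.X + ∑ w ∈ Sf, charLocalLambda ∅ κ θsub w :=
    (BadPrimeCharImprimitiveShiftOfPT.imprimitive_clauses_of_not_good forall_poitouTate_shaRestricted_tateDual_natural_at_of_isTotallyComplex W
      hp2 haddv.1 hK hH hv hvbar hne κ hκ γ hpair Sf hSf θsub (Or.inl rfl) hRHsub Dsub DSsub).2.2.2
  have hlquot : lambdaInvariant p DSquot.X = lambdaInvariant p Dquot.X + ∑ w ∈ Sf, charLocalLambda ∅ κ θquot w :=
    (BadPrimeCharImprimitiveShiftOfPT.imprimitive_clauses_of_not_good forall_poitouTate_shaRestricted_tateDual_natural_at_of_isTotallyComplex W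
      hp2 haddv.1 hK hH hv hvbar hne κ hκ γ hpair Sf hSf θquot (Or.inr rfl) hRHquot Dquot DSquot).2.2.2
  obtain ⟨hSs, hSq, ⟨hfgS, htorS, hμS⟩, -⟩ := xAc_clauses_of_primitive_clauses W hp2 haddv.1 K hK hH ι v vbar hv hvbar hne κ hκ γ θsub θquot hpair
    Sf hSf hRHsub hRHquot
  have hmain := lambdaInvariant_add_eq_of_decomp_ne_one_offP W hp2 haddv K hK hH ι v vbar hv hvbar hne κ hκ γ θsub θquot hpair hsubD hquotD Sf
    hSf DSsub DSquot hfgS htorS hμS hSs hSq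
  rw [hlsub, hlquot] at hmain
  rw [Finset.sum_add_distrib]
  omega

/-! ### §4 The door inequality in the hinge's shape, CGLS-§1.2-free -/

/-- **THE DOOR INEQUALITY, CGLS-§1.2-FREE:** for `W/ℚ` globally minimal with ADDITIVE reduction at an odd `p`, `K` imaginary quadratic Heegner for `N_W` with
`(p) = v v̄` (`ι` inducing `v`), `κ` anticyclotomic with generator `γ`, `(θsub, θquot)` a residual pair of `W_K[p]` with BOTH characters
non-trivial on `D_v̄` (so `W(K)[p] = 0`, §0), `Sf` the `p`-free places over `N_W`, primitive unramified dual data `Dsub`, `Dquot`, and the primitive clauses `hRHsub`, `hRHquot`: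
`λ(Dsub.X) + λ(Dquot.X) + Σ_{w∈Sf}(λ𝒫_w(θsub) + λ𝒫_w(θquot)) ≤ λ(X_ac^∅(W_K)) + Σ_{w∈Sf} λ𝒫_w(W_K)`, AND `X_ac^∅(W_K)` is `Λ`-torsion with `μ = 0`.
§3 + cell `bsd-eis`'s λ-shift `λ(X^{Sf}) = λ(X^∅) + corank(Sel^{Sf}/Sel^∅)` ([INV.μ] at `Sf`, §2) + `corank ≤ Σ λ𝒫_w(W_K)` (`FSideCorankLeOffP`, unconditional).
This is the shape of this seat's `KYLambdaAlgOfCGLS.add_add_sum_le_lambdaInvariant_xAc_empty_add_sum_curveLocalLambda_of_nonAnomalous_ofCGLS` (F38a) WITHOUT its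
five named binders (CGLS 2022 Prop. 1.2.5 ×2, Prop. 14, Cor. 1.2.6 (i)(ii), Milne I 4.10 (a)).  No named hypothesis.
[cite: KellerYin2024, Thm. 1.4.1 and proof of Thm. 1.5.1 (arXiv:2402.12781v2)] [cite: GreenbergVatsal2000, §2 Prop. (2.8), Cor. (2.3)] -/
theorem add_add_sum_le_lambdaInvariant_xAc_empty_add_sum_curveLocalLambda_of_decomp_ne_one
    (W : WeierstrassCurve ℚ) [W.IsElliptic] [W.IsGloballyMinimal] (hp2 : 2 < p) (haddv : Addv W p)
    (K : Type) [Field K] [NumberField K] (hK : IsImaginaryQuadratic K)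
    (hH : SatisfiesHeegnerHypothesis (W.conductorNorm ℤ) K)
    (ι : K →+* ℚ_[p]) (v vbar : HeightOneSpectrum (𝓞 K))
    (hv : ∀ x : 𝓞 K, x ∈ v.asIdeal ↔ ‖ι (x : K)‖ < 1)
    (hvbar : ((p : ℕ) : 𝓞 K) ∈ vbar.asIdeal) (hne : vbar ≠ v)
    (κ : ZpExtension K p) (hκ : κ.IsAnticyclotomic)
    (γ : absoluteGaloisGroup K) [hγ : Fact (κ.IsTopGenerator γ)]
    (θsub θquot : FramedGaloisRep K (padicCoeffIntegers (∅ : Set (PadicAlgCl p))) 1)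
    (hpair : IsResidualPairOver (W.baseChange K) p θsub θquot)
    (hsubD : ∃ τ ∈ decomp vbar, unitChar θsub τ ≠ 1) (hquotD : ∃ τ ∈ decomp vbar, unitChar θquot τ ≠ 1)
    (Sf : Finset (HeightOneSpectrum (𝓞 K)))
    (hSf : ∀ w : HeightOneSpectrum (𝓞 K), w ∈ Sf ↔
      (((W.conductorNorm ℤ : ℤ) : 𝓞 K) ∈ w.asIdeal ∧ ((p : ℕ) : 𝓞 K) ∉ w.asIdeal))
    (Dsub : DatumDualData κ γ (charModule ∅ θsub)
        (AcSelmer.bdpData (charModule ∅ θsub) p vbar) (∅ : Set (HeightOneSpectrum (𝓞 K))))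
    (Dquot : DatumDualData κ γ (charModule ∅ θquot)
        (AcSelmer.bdpData (charModule ∅ θquot) p vbar) (∅ : Set (HeightOneSpectrum (𝓞 K))))
    (hRHsub : ∀ D : DatumDualData κ γ (charModule ∅ θsub)
        (AcSelmer.bdpData (charModule ∅ θsub) p vbar) (∅ : Set (HeightOneSpectrum (𝓞 K))),
      Module.Finite (IwasawaAlgebra p) D.X ∧ Module.IsTorsion (IwasawaAlgebra p) D.X ∧ muInvariant p D.X = 0)
    (hRHquot : ∀ D : DatumDualData κ γ (charModule ∅ θquot)
        (AcSelmer.bdpData (charModule ∅ θquot) p vbar) (∅ : Set (HeightOneSpectrum (𝓞 K))),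
      Module.Finite (IwasawaAlgebra p) D.X ∧ Module.IsTorsion (IwasawaAlgebra p) D.X ∧ muInvariant p D.X = 0) :
    (Module.IsTorsion (IwasawaAlgebra p) (AcSelmer.XAc (W.baseChange K) p κ vbar (∅ : Set (HeightOneSpectrum (𝓞 K))) γ) ∧
      muInvariant p (AcSelmer.XAc (W.baseChange K) p κ vbar (∅ : Set (HeightOneSpectrum (𝓞 K))) γ) = 0) ∧
    lambdaInvariant p Dsub.X + lambdaInvariant p Dquot.X +
        ∑ w ∈ Sf, (charLocalLambda ∅ κ θsub w + charLocalLambda ∅ κ θquot w) ≤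
      lambdaInvariant p (AcSelmer.XAc (W.baseChange K) p κ vbar (∅ : Set (HeightOneSpectrum (𝓞 K))) γ) +
        ∑ w ∈ Sf, curveLocalLambda κ (W.baseChange K) w := by
  haveI hEK : (W.baseChange K).IsElliptic := inferInstanceAs (W.map (algebraMap ℚ K)).IsElliptic
  have halg := lambdaInvariant_primitive_add_sum_eq_of_decomp_ne_one W hp2 haddv K hK hH ι v vbar hv hvbar hne κ hκ γ θsub θquot hpair hsubD hquotD
    Sf hSf Dsub Dquot hRHsub hRHquot
  obtain ⟨-, -, ⟨hfgS, htorS, hμS⟩, h0⟩ := xAc_clauses_of_primitive_clauses W hp2 haddv.1 K hK hH ι v vbar hv hvbar hne κ hκ γ θsub θquot hpair Sf hSf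
    hRHsub hRHquot
  haveI := hfgS
  obtain ⟨-, -, -, -, hshift⟩ := XAcImprimitiveLambdaShift.lambdaInvariant_eq_add_zpCorank_of_muInvariant_eq_zero (W.baseChange K) p κ
    vbar γ (S₁ := (∅ : Set (HeightOneSpectrum (𝓞 K)))) (S₂ := (↑Sf : Set (HeightOneSpectrum (𝓞 K)))) (Set.empty_subset _) htorS hμS
  have hcork := FSideCorankLeOffP.zpCorank_selmerAc_quotient_le_sum_curveLocalLambda_of_offP_iff W hp2 hK hH κ hκ hγ.out vbar Sf hSf
  refine ⟨h0, ?_⟩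
  rw [hshift] at halg
  omega

end Summit.BirchSwinnertonDyer.BirchSwinnertonDyer.Theorems.SchneiderFreeAdditiveX3.NATLambdaAlgebraicSide

end
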